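import Literature.MathematicalPhysics.QuantumFieldTheory.Balaban1983to89.B9Eq328GaugeAction
import Literature.MathematicalPhysics.QuantumFieldTheory.Balaban1983to89.B9Eq323KatoDomination

/-!
# `Balaban1983to89.B9Eq331PureGaugeResolventConjugation` — T. Bałaban, *Propagators for lattice gauge theories in a background field*, Commun. Math. Phys.
# **99** (1985) 389–434 [Balaban1985BackgroundPropagators] (3.28)–(3.31) p. 395 (gauge transformations `U → U^u`, `R(u)`, and *«⟨R(u)λ, Δ^η_{U^u}R(u)λ⟩ =
# ⟨λ, Δ^η_Uλ⟩»*), (3.23) p. 394, (3.35)–(3.36) p. 396 (the regularity gauge on a cube), Thm 3.1 (3.42) p. 397 and p. 398 *«All these inequalities are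
# invariant with respect to gauge transformations of U»*: **THE PURE-GAUGE RESOLVENT AND ITS COVARIANT GRADIENT ARE THE GAUGED FLAT ONES — IN THE CHAIN's
# OWN CURRENCY.**  For the pure gauge `U⁰ = 1^g` (`U⁰(b) = g(b₋)g(b₊)⁻¹`, `B9Eq328GaugeAction.gaugeU g 1`) of the chain's periodic lattice `TSite d P` and
# its Kato-form Laplacian `B11Eq103H1Complex.covLaplaceSiteK` at the chain's transporters `adTransportW φ U⁰`: a solution `u` of `Δ^η_{U⁰}u + m u = h` is
# `R(g)v` for the solution `v = R(g⁻¹)u` of the FLAT equation `Δ^η_{1}v + m v = R(g⁻¹)h`; read pointwise, `v` solves the explicit flat site equation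
# `Σ_ν t²•((v x − v(x−e_ν)) + (v x − v(x+e_ν))) + m•v x = k x` with `‖k y‖ = ‖h y‖`; and the covariant gradient is conjugated, `(∇_{U⁰}u)(b) =
# R(g(b₋))(∇_1 v)(b)`, so `‖(∇_{U⁰}u)(b)‖ = |c|·‖v(b₊) − v(b₋)‖`.  HENCE EVERY FLAT SOLUTION-SHAPE GRADIENT-ROW LETTER (any weight, any constants)
# HOLDS VERBATIM FOR THE COVARIANT GRADIENT OF THE PURE-GAUGE RESOLVENT — the `hT` letter storey J's bootstrap (`B9Eq342GradientRowBootstrap` §4) asks of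
# its comparison background (t4-ne9-idea-1 g121 §2 (BG)∕(PG): *«pure-gauge twin by unitary conjugation ([folklore])»*)

statement-level skeleton of published theorems with citation tags; proofs where landed; nothing here is a claim about the Yang–Mills mass gap

CITATION HEADER (lean-in-tree rule).  Audit cell `pub-balaban`, sub-cell `t4`, BINDER row NE9; filed by NE9 crux-team LEAF PROVER 05
(`b2b-balaban-t4-ne9-formalise-leaf-05`, gen 82; §6 gen 83).  SOURCE READ first-hand in the held text layer [Balaban1985BackgroundPropagators]
(`paper:balaban1985-cmp99-background-propagators`, journal page = PDF page + 388): p. 395 (3.28)–(3.31) *«U^u(x,x′) = u(x)U(x,x′)u⁻¹(x′) … R(U^u(Γ)) =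
R(u(y))R(U(Γ))R(u⁻¹(x)) … ⟨R(u)λ, Δ^η_{U^u}R(u)λ⟩ = ⟨λ, Δ^η_Uλ⟩»*; p. 396 (3.35) *«for an arbitrary cube □ … there exists a gauge transformation u on □ such that
U^u = e^{iηA}, and … |A| < O(1)Mα₀(L^jη)⁻¹, |∇^ηA| < O(1)Mα₀(L^jη)⁻²»*; p. 398 *«All these inequalities are invariant with respect to gauge transformations of U.»*
The lemma is [folklore] (a gauge transformation is an isometric change of variables in every fibre; a pure gauge is the transform of the trivial background);
nothing printed is a hypothesis except the fibrewise isometry `hAd` of `R(g(x))` (unitarity of `g(x)` in the norming — the displayed hypothesis of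
`B9Eq328GaugeAction` §3–§4, DERIVED there and in `B9Eq387CubeReductionGaugeBackground` §2 for unitary `g`).
WHY A SECOND FILE NEXT TO `B9Eq335PureGaugeGradientRow` (this lineage, gen 82): that letter is ABSTRACT (a real normed space, `g x` abstract linear isometries,
the equation as an explicit sum); THIS file is the CHAIN INSTANCE its honest scope names as not typed — background `gaugeU g 1 : Bond d P → 𝔸ˣ`, transporters
`adTransportW φ`, the Laplacian `covLaplaceSiteK` and gradient `covDerivL2K` of `B11Eq103H1Complex` on `SiteL2K ℂ d P c₀ W`, the gauge action `gaugeW φ g` of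
`B9Eq328GaugeAction` — so that storey J's consumer composes BY ONE TERM with the OWNER t4-ne9-p1's resolvent vocabulary, and with the flat (K∇) supplier
`B5Eq129FreeResolventGradientRowSites` (whose output is the `Hflat` shape below) when its parents build.

WHAT IS PROVED (sorry-free; 0 `def`; [folklore]).  `φ : W ≃ₗ[ℂ] 𝔸` the fibre chart, `g : TSite d P → 𝔸ˣ` the gauge, `U⁰ := gaugeU g 1`, flat transporters
`adTransportW φ 1`, `adTransportW φ (fun b => (1 b)⁻¹)` (both the identity: `adTransportW_one_apply`, `adTransportW_one_inv_apply`); `t m : ℝ`, `c : ℂ`.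
* §1 **`gaugeU_one_apply`** `U⁰(b) = g(b₋)·g(b₊)⁻¹`; **`norm_AdW_of_hAd`**, **`norm_AdW_inv_of_hAd`** `‖R(g x)v‖ = ‖v‖ = ‖R((g x)⁻¹)v‖`; **`norm_equiv_gaugeW_inv`**.
* §2 **`covLaplaceSiteK_pureGauge`** `Δ_{U⁰}u = R(g)(Δ_1(R(g⁻¹)u))`; **`flat_resolvent_of_pureGauge`** `Δ_{U⁰}u + m u = h ⟹ Δ_1(R(g⁻¹)u) + m(R(g⁻¹)u) = R(g⁻¹)h`;
  **`explicit_flat_equation`** the flat `SiteL2K` equation read pointwise as the explicit real site equation (the (K∇) suppliers' input shape);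
  **`explicit_flat_equation_of_pureGauge`** the two composed.
* §3 **`covDerivL2K_pureGauge`** `∇_{U⁰}u = R(g∘b₋)(∇_1(R(g⁻¹)u))`; **`norm_equiv_covDerivL2K_pureGauge`** `‖(∇_{U⁰}u)(b)‖ = ‖c‖·‖v(b₊) − v(b₋)‖`, `v = R(g⁻¹)u` read pointwise.
* §5 **`adTransportW_gaugeU_sub_pureGauge`**, **`…_inv_sub_pureGauge`** (`R(V^g(b)) − R(1^g(b)) = R(g b₋)(R(V b) − 1)R(g b₊)⁻¹` and the adjoint law);
  **`norm_adTransportW_gaugeU_sub_pureGauge_le`**, **`norm_adTransportW_gaugeU_inv_sub_pureGauge_le`** (`‖R(U(b))w − R(U⁰(b))w‖ ≤ ε‖w‖` from the displayed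
  `‖R(V(b))w′ − w′‖ ≤ ε‖w′‖` — the `hRR′`∕`hSS′` binders of the two-background letters for storey J's pair `(U, U⁰) = (V^g, 1^g)`).
* §4 **`norm_covDeriv_pureGauge_le_of_flat`** — THE LETTER: `Hflat` (for ALL plain `V K : TSite d P → W`, `F`: explicit flat equation ∧ `‖K y‖ ≤ F·Ws y` ⟹
  `‖V(b₊) − V(b₋)‖ ≤ Bb b·F` for every bond) ⟹ for every solution of `Δ_{U⁰}u + m u = h` with `‖h y‖ ≤ F·Ws y`: `‖(∇_{U⁰}u)(b)‖ ≤ ‖c‖·(Bb b·F)` — same weight,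
  same constants (print p. 398).
* §6 (gen 83) THE PAIRED-REMAINDER LETTERS OF THE PAIR: **`relTransporter_pureGauge_apply`** `R(U⁰(b))R(U(b)⁻¹) = R(g b₋)R(V(b)⁻¹)R(g b₋)⁻¹`;
  **`covDiff_relTransporter_pureGauge_eq`** — the `U⁰`-covariant difference of `B = R(U⁰)R(U⁻¹) − 1` along the bond direction at `x` is
  `R(g x)(R(V(x,μ)⁻¹) − R(V(x−e_μ,μ)⁻¹))R(g x)⁻¹`; hence the transporter binders of `B9Eq373KatoPairedRemainder.norm_equiv_covLaplaceSiteK_sub_le_paired` for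
  `(U⁰, U) = (1^g, V^g)` from displayed fibre letters on `V`: `hS` (**`norm_adTransportW_pureGauge_inv`**), `hR′` (**`norm_adTransportW_gaugeU_le`**), `hBp`∕`hBm`
  (**`norm_relTransporter_pureGauge_sub_le`**), `hBt` (**`norm_adTransportW_pureGauge_inv_sub_gaugeU_inv_le`**), the (3.73) `|∇_U B|` letter `hD`
  (**`norm_covDiff_relTransporter_pureGauge_le`**, from `‖R(V(x,μ)⁻¹)w − R(V(x−e_μ,μ)⁻¹)w‖ ≤ ε′‖w‖`; print's units: `ε′ = O(η²|∇^ηA|)`, so the zeroth order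
  `η⁻²(b′ + b²)` of the paired bound is `η`-free); the other order `(U, U⁰)`: **`relTransporter_gaugeU_apply`**, **`…_sub_le`**, **`covDiff_relTransporter_gaugeU_eq`**, **`…_le`**.
HONEST SCOPE.  Plumbing; `Hflat`, §5's `hV`∕`hV′` and §6's `hdV`∕`hdV′` are NOT discharged here (`hV`: `B9Eq384RemainderLetters.norm_adTransportW_sub_le`, not imported;
`hdV′`: a fibre Lipschitz letter `‖R(u)w − R(v)w‖ ≤ 2M_φM_φ′‖u − v‖‖w‖` composed with the gauge (3.35)'s `‖V(x,μ) − V(x−e_μ,μ)‖ = O(η²|∇^ηA|)` — neither in the tree at filing) (its supplier is the (K∇) chain `B5Eq129FreeResolventGradientRow` → `…Weighted` → `…GradientRowSites`,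
partly behind the build lane at filing); `hAd` displayed, not derived (see above); ONE lattice, no tower index, no block structure; the comparison background of
storey J is `U⁰ = gaugeU g 1` for print's (3.35) gauge `g` on a cube — the EXISTENCE of that gauge and the smallness of `U − U⁰` there are
`B9Eq387CubeReductionGaugeBackground` ∕ (3.35), NOT this file; the averaging penalty `a′Q′*Q′` of (3.24) is not of Kato form and is not treated.  NOT summit
progress (cell pub-balaban: NE9 NOT PRINTED ∕ NOT PROVED; «NE9 ⇐ the named binders»; row WALLED ON A MODEL (O-NE9-1; #5 UNRULED); spine PROVED 0∕9; rung (B)+1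
finite T⁴ — NOT infinite volume, NOT mass gap, NOT BetaPertH, NOT Clay).  HONEST DEPENDENCY (cell line): continuum YM on T⁴ ⇐ BetaPertH ∧ nine spine estimates
(0/9 proved); BetaPertH ⇐ (D1) ∧ (D4) ∧ CAP+tail; G-an2-4 gates asym, D1 and NE2/3/4.  NEW file importing `B9Eq328GaugeAction` and `B9Eq323KatoDomination`
(both built); nothing modified.  Net new unproved facts: 0.
-/

noncomputable section

open scoped BigOperators InnerProductSpace

namespace Literature.MathematicalPhysics.QuantumFieldTheory.Balaban1983to89.B9Eq331PureGaugeResolventConjugation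

open B4Sect5Torus (TSite)
open B9SectCLatticeCarrier (Bond bpos btgt shift unshift shift_unshift)
open B9Eq33CovDerivVector (covDeriv covDeriv_apply)
open B9Eq311L2Pairing (WL2)
open B9Eq310HessianOperator (adTransportW)
open B11Eq103H1Complex (SiteL2K covLaplaceSiteK covDerivL2K equiv_covDerivL2K)
open B9Eq323KatoDomination (equiv_covLaplaceSiteK_eq_sum)
open B9Eq328GaugeAction (gaugeU gaugeU_apply AdW AdW_apply AdW_apply_inv adTransportW_eq_AdW gaugeW equiv_gaugeW gaugeW_apply_inv gaugeW_inv_apply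
  covLaplaceSiteK_gaugeU covDerivL2K_gaugeU)

variable {d : ℕ} {Pd : Fin d → ℕ} {𝔸 : Type*} [Ring 𝔸] [Algebra ℂ 𝔸] {W : Type*} [NormedAddCommGroup W] [InnerProductSpace ℂ W] (φ : W ≃ₗ[ℂ] 𝔸)
  {c₀ : ℝ} [Fact (0 < c₀)] (g : TSite d Pd → 𝔸ˣ)

/-! ## §1 The pure gauge `U⁰ = 1^g`, the flat transporters, and the fibrewise isometry -/

omit [Algebra ℂ 𝔸] in
/-- **`U⁰(b) = g(b₋)g(b₊)⁻¹`**: the gauge transform of the trivial background. [cite: Balaban1985BackgroundPropagators, (3.28) p.395, (3.35) p.396] -/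
theorem gaugeU_one_apply (b : Bond d Pd) : gaugeU g (1 : Bond d Pd → 𝔸ˣ) b = g (bpos b) * (g (btgt b))⁻¹ := by
  rw [gaugeU_apply, Pi.one_apply, mul_one]

/-- The flat transporter `R(1) = 1` on the fibre. [folklore] [cite: Balaban1985BackgroundPropagators, (3.3) p.391] -/
theorem adTransportW_one_apply (b : Bond d Pd) (w : W) : adTransportW φ (1 : Bond d Pd → 𝔸ˣ) b w = w := by
  rw [adTransportW_eq_AdW, Pi.one_apply, AdW_apply, Units.val_one, inv_one, Units.val_one, one_mul, mul_one, LinearEquiv.symm_apply_apply]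

/-- The flat adjoint transporter `R(1⁻¹) = 1` on the fibre. [folklore] [cite: Balaban1985BackgroundPropagators, (3.8) p.392] -/
theorem adTransportW_one_inv_apply (b : Bond d Pd) (w : W) : adTransportW φ (fun b => ((1 : Bond d Pd → 𝔸ˣ) b)⁻¹) b w = w := by
  rw [adTransportW_eq_AdW, Pi.one_apply, inv_one, AdW_apply, Units.val_one, inv_one, Units.val_one, one_mul, mul_one, LinearEquiv.symm_apply_apply]

/-- `‖R(g x)v‖ = ‖v‖` from the fibrewise isometry `hAd`. [folklore] [cite: Balaban1985BackgroundPropagators, (3.30) p.395] -/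
theorem norm_AdW_of_hAd (hAd : ∀ (x : TSite d Pd) (v v' : W), ⟪AdW φ (g x) v, AdW φ (g x) v'⟫_ℂ = ⟪v, v'⟫_ℂ) (x : TSite d Pd) (v : W) :
    ‖AdW φ (g x) v‖ = ‖v‖ := by
  rw [norm_eq_sqrt_re_inner (𝕜 := ℂ) (AdW φ (g x) v), norm_eq_sqrt_re_inner (𝕜 := ℂ) v, hAd]

/-- `‖R((g x)⁻¹)v‖ = ‖v‖` from the fibrewise isometry `hAd`. [folklore] [cite: Balaban1985BackgroundPropagators, (3.30) p.395] -/
theorem norm_AdW_inv_of_hAd (hAd : ∀ (x : TSite d Pd) (v v' : W), ⟪AdW φ (g x) v, AdW φ (g x) v'⟫_ℂ = ⟪v, v'⟫_ℂ) (x : TSite d Pd) (v : W) :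
    ‖AdW φ (g x)⁻¹ v‖ = ‖v‖ := by
  conv_rhs => rw [← AdW_apply_inv φ (g x) v]
  rw [norm_AdW_of_hAd φ g hAd]

omit [Fact (0 < c₀)] in
/-- **`‖(R(g⁻¹)u)(y)‖ = ‖u(y)‖`** on the site carrier. [folklore] [cite: Balaban1985BackgroundPropagators, (3.30) p.395] -/
theorem norm_equiv_gaugeW_inv (hAd : ∀ (x : TSite d Pd) (v v' : W), ⟪AdW φ (g x) v, AdW φ (g x) v'⟫_ℂ = ⟪v, v'⟫_ℂ) (u : SiteL2K ℂ d Pd c₀ W)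
    (y : TSite d Pd) : ‖WL2.equiv ℂ _ W (gaugeW φ g⁻¹ u) y‖ = ‖WL2.equiv ℂ _ W u y‖ := by
  rw [equiv_gaugeW, Pi.inv_apply, norm_AdW_inv_of_hAd φ g hAd]

/-! ## §2 The pure-gauge resolvent is the gauged flat resolvent -/

/-- **`Δ^η_{U⁰}u = R(g)(Δ^η_1(R(g⁻¹)u))`** for the pure gauge `U⁰ = 1^g` ((3.31) at `U = 1`). [folklore] [cite: Balaban1985BackgroundPropagators, (3.31) p.395, (3.23) p.394] -/
theorem covLaplaceSiteK_pureGauge (c : ℂ) (u : SiteL2K ℂ d Pd c₀ W) :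
    covLaplaceSiteK c (adTransportW φ (gaugeU g 1)) (adTransportW φ fun b => (gaugeU g 1 b)⁻¹) u =
      gaugeW φ g (covLaplaceSiteK c (adTransportW φ (1 : Bond d Pd → 𝔸ˣ)) (adTransportW φ fun b => ((1 : Bond d Pd → 𝔸ˣ) b)⁻¹) (gaugeW φ g⁻¹ u)) := by
  rw [← covLaplaceSiteK_gaugeU φ c g 1 (gaugeW φ g⁻¹ u), gaugeW_apply_inv]

/-- **THE PURE-GAUGE RESOLVENT IS THE GAUGED FLAT RESOLVENT**: `Δ^η_{U⁰}u + m u = h ⟹ Δ^η_1 v + m v = R(g⁻¹)h` for `v = R(g⁻¹)u`. [folklore]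
[cite: Balaban1985BackgroundPropagators, (3.31) p.395, (3.23) p.394, p.398] -/
theorem flat_resolvent_of_pureGauge (c m : ℂ) {u h : SiteL2K ℂ d Pd c₀ W}
    (hu : covLaplaceSiteK c (adTransportW φ (gaugeU g 1)) (adTransportW φ fun b => (gaugeU g 1 b)⁻¹) u + m • u = h) :
    covLaplaceSiteK c (adTransportW φ (1 : Bond d Pd → 𝔸ˣ)) (adTransportW φ fun b => ((1 : Bond d Pd → 𝔸ˣ) b)⁻¹) (gaugeW φ g⁻¹ u) +
      m • gaugeW φ g⁻¹ u = gaugeW φ g⁻¹ h := by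
  have e := congr_arg (gaugeW φ g⁻¹) hu
  rw [map_add, map_smul, covLaplaceSiteK_pureGauge, gaugeW_inv_apply] at e
  exact e

/-- **THE FLAT `SiteL2K` EQUATION READ POINTWISE** is the explicit real site equation `Σ_ν t²•((v x − v(x−e_ν)) + (v x − v(x+e_ν))) + m•v x = k x` — the input
shape of the flat (K∇) suppliers (`B5Eq129FreeResolventGradientRowSites`). [folklore] [cite: Balaban1985BackgroundPropagators, (3.23) p.394; Balaban1984PropagatorsI, (1.29) p.582] -/
theorem explicit_flat_equation (t m : ℝ) {v k : SiteL2K ℂ d Pd c₀ W}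
    (hv : covLaplaceSiteK (t : ℂ) (adTransportW φ (1 : Bond d Pd → 𝔸ˣ)) (adTransportW φ fun b => ((1 : Bond d Pd → 𝔸ˣ) b)⁻¹) v + (m : ℂ) • v = k)
    (x : TSite d Pd) :
    ∑ ν, t ^ 2 • ((WL2.equiv ℂ _ W v x - WL2.equiv ℂ _ W v (unshift ν x)) + (WL2.equiv ℂ _ W v x - WL2.equiv ℂ _ W v (shift ν x))) +
      m • WL2.equiv ℂ _ W v x = WL2.equiv ℂ _ W k x := by
  have e := congr_arg (fun f => WL2.equiv ℂ _ W f x) hv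
  simp only [WL2.equiv_add, WL2.equiv_smul, Pi.add_apply, Pi.smul_apply] at e
  have hs := equiv_covLaplaceSiteK_eq_sum (𝕜 := ℂ) t (adTransportW φ (1 : Bond d Pd → 𝔸ˣ)) (adTransportW φ fun b => ((1 : Bond d Pd → 𝔸ˣ) b)⁻¹)
    (fun b w => by rw [adTransportW_one_apply, adTransportW_one_inv_apply]) v x
  rw [RCLike.ofReal_eq_complex_ofReal] at hs
  rw [hs] at e
  simp only [adTransportW_one_apply, adTransportW_one_inv_apply, Complex.coe_smul] at e
  exact e

/-- **§2 composed**: for the pure gauge `U⁰ = 1^g`, `v = R(g⁻¹)u` read pointwise solves the explicit flat site equation with datum `k = R(g⁻¹)h` read pointwise.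
[folklore] [cite: Balaban1985BackgroundPropagators, (3.31) p.395, (3.23) p.394, p.398] -/
theorem explicit_flat_equation_of_pureGauge (t m : ℝ) {u h : SiteL2K ℂ d Pd c₀ W}
    (hu : covLaplaceSiteK (t : ℂ) (adTransportW φ (gaugeU g 1)) (adTransportW φ fun b => (gaugeU g 1 b)⁻¹) u + (m : ℂ) • u = h) (x : TSite d Pd) :
    ∑ ν, t ^ 2 • ((WL2.equiv ℂ _ W (gaugeW φ g⁻¹ u) x - WL2.equiv ℂ _ W (gaugeW φ g⁻¹ u) (unshift ν x)) +
        (WL2.equiv ℂ _ W (gaugeW φ g⁻¹ u) x - WL2.equiv ℂ _ W (gaugeW φ g⁻¹ u) (shift ν x))) + m • WL2.equiv ℂ _ W (gaugeW φ g⁻¹ u) x =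
      WL2.equiv ℂ _ W (gaugeW φ g⁻¹ h) x :=
  explicit_flat_equation φ t m (flat_resolvent_of_pureGauge φ g (t : ℂ) (m : ℂ) hu) x

/-! ## §3 The covariant gradient of the pure-gauge resolvent is the conjugated flat gradient -/

/-- **`∇_{U⁰}u = R(g∘b₋)(∇_1(R(g⁻¹)u))`** ((3.3) is covariant, at `U = 1`). [folklore] [cite: Balaban1985BackgroundPropagators, (3.3) p.390, (3.30)–(3.31) p.395] -/
theorem covDerivL2K_pureGauge (c : ℂ) (u : SiteL2K ℂ d Pd c₀ W) :
    covDerivL2K ℂ c₀ c (adTransportW φ (gaugeU g 1)) u =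
      gaugeW φ (fun b : Bond d Pd => g (bpos b)) (covDerivL2K ℂ c₀ c (adTransportW φ (1 : Bond d Pd → 𝔸ˣ)) (gaugeW φ g⁻¹ u)) := by
  rw [← covDerivL2K_gaugeU φ c g 1 (gaugeW φ g⁻¹ u), gaugeW_apply_inv]

/-- **`‖(∇_{U⁰}u)(b)‖ = ‖c‖·‖v(b₊) − v(b₋)‖`** with `v = R(g⁻¹)u` read pointwise (isometry of `R(g(b₋))`, flat transporter `= 1`). [folklore]
[cite: Balaban1985BackgroundPropagators, (3.3) p.390, (3.30) p.395, p.398] -/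
theorem norm_equiv_covDerivL2K_pureGauge (hAd : ∀ (x : TSite d Pd) (v v' : W), ⟪AdW φ (g x) v, AdW φ (g x) v'⟫_ℂ = ⟪v, v'⟫_ℂ) (c : ℂ)
    (u : SiteL2K ℂ d Pd c₀ W) (b : Bond d Pd) :
    ‖WL2.equiv ℂ _ W (covDerivL2K ℂ c₀ c (adTransportW φ (gaugeU g 1)) u) b‖ =
      ‖c‖ * ‖WL2.equiv ℂ _ W (gaugeW φ g⁻¹ u) (btgt b) - WL2.equiv ℂ _ W (gaugeW φ g⁻¹ u) (bpos b)‖ := by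
  rw [covDerivL2K_pureGauge, equiv_gaugeW, norm_AdW_of_hAd φ g hAd, equiv_covDerivL2K, covDeriv_apply, adTransportW_one_apply, norm_smul]

/-! ## §4 The letter: every flat solution-shape gradient row holds for the covariant gradient of the pure-gauge resolvent -/

/-- **THE PURE-GAUGE GRADIENT ROW FROM THE FLAT ONE, IN THE CHAIN's CURRENCY.**  Let `Hflat` be a flat solution-shape gradient-row letter on `TSite d P` for a site
weight `Ws` and bond constants `Bb` (weight at either end and the direction constant absorbed): for ALL plain `V K : TSite d P → W` and `F`, the explicit flat
equation `Σ_ν t²•((V x − V(x−e_ν)) + (V x − V(x+e_ν))) + m•V x = K x` with `‖K y‖ ≤ F·Ws y` gives `‖V(b₊) − V(b₋)‖ ≤ Bb b·F` at every bond.  Then for the pure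
gauge `U⁰ = 1^g` (`g` fibrewise isometric, `hAd`) and every solution of `Δ^η_{U⁰}u + m u = h` in `SiteL2K` with `‖h y‖ ≤ F·Ws y`:
`‖(∇_{U⁰}u)(b)‖ ≤ ‖c‖·(Bb b·F)` — the same letter, same weight, same constants (print p. 398: gauge invariance of (3.42)); the `hT` binder of storey J's
`B9Eq342GradientRowBootstrap` §4 for the comparison background.  Proof: §2 + §1 (`‖(R(g⁻¹)h)(y)‖ = ‖h(y)‖`) + §3. [folklore]
[cite: Balaban1985BackgroundPropagators, Thm 3.1 (3.42) p.397, p.398, (3.31) p.395, (3.35) p.396] -/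
theorem norm_covDeriv_pureGauge_le_of_flat (hAd : ∀ (x : TSite d Pd) (v v' : W), ⟪AdW φ (g x) v, AdW φ (g x) v'⟫_ℂ = ⟪v, v'⟫_ℂ)
    {t m : ℝ} {Ws : TSite d Pd → ℝ} {Bb : Bond d Pd → ℝ}
    (Hflat : ∀ (V K : TSite d Pd → W) (F : ℝ),
      (∀ x, ∑ ν, t ^ 2 • ((V x - V (unshift ν x)) + (V x - V (shift ν x))) + m • V x = K x) →
      (∀ y, ‖K y‖ ≤ F * Ws y) → ∀ b : Bond d Pd, ‖V (btgt b) - V (bpos b)‖ ≤ Bb b * F)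
    (c : ℂ) {u h : SiteL2K ℂ d Pd c₀ W}
    (hu : covLaplaceSiteK (t : ℂ) (adTransportW φ (gaugeU g 1)) (adTransportW φ fun b => (gaugeU g 1 b)⁻¹) u + (m : ℂ) • u = h)
    {F : ℝ} (hh : ∀ y, ‖WL2.equiv ℂ _ W h y‖ ≤ F * Ws y) (b : Bond d Pd) :
    ‖WL2.equiv ℂ _ W (covDerivL2K ℂ c₀ c (adTransportW φ (gaugeU g 1)) u) b‖ ≤ ‖c‖ * (Bb b * F) := by
  rw [norm_equiv_covDerivL2K_pureGauge φ g hAd]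
  exact mul_le_mul_of_nonneg_left
    (Hflat _ _ F (explicit_flat_equation_of_pureGauge φ g t m hu) (fun y => by rw [norm_equiv_gaugeW_inv φ g hAd]; exact hh y) b) (norm_nonneg c)

/-! ## §5 The companion smallness letter: a background gauge-equivalent to a near-trivial one is near its pure-gauge skeleton, transporter by transporter -/

section Smallness

variable (V : Bond d Pd → 𝔸ˣ)

/-- **`R(U(b)) − R(U⁰(b)) = R(g(b₋))·(R(V(b)) − 1)·R(g(b₊))⁻¹`** for `U = V^g` and its pure-gauge skeleton `U⁰ = 1^g`. [folklore]
[cite: Balaban1985BackgroundPropagators, (3.28) p.395, (3.32) p.395, (3.35) p.396] -/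
theorem adTransportW_gaugeU_sub_pureGauge (b : Bond d Pd) (w : W) :
    adTransportW φ (gaugeU g V) b w - adTransportW φ (gaugeU g 1) b w =
      AdW φ (g (bpos b)) (adTransportW φ V b (AdW φ (g (btgt b))⁻¹ w) - AdW φ (g (btgt b))⁻¹ w) := by
  rw [B9Eq328GaugeAction.adTransportW_gaugeU, B9Eq328GaugeAction.adTransportW_gaugeU, adTransportW_one_apply, map_sub]

/-- The same for the ADJOINT transporters: `R(U(b)⁻¹) − R(U⁰(b)⁻¹) = R(g(b₊))·(R(V(b)⁻¹) − 1)·R(g(b₋))⁻¹`. [folklore]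
[cite: Balaban1985BackgroundPropagators, (3.28) p.395, (3.8) p.392, (3.35) p.396] -/
theorem adTransportW_gaugeU_inv_sub_pureGauge (b : Bond d Pd) (w : W) :
    adTransportW φ (fun b => (gaugeU g V b)⁻¹) b w - adTransportW φ (fun b => (gaugeU g 1 b)⁻¹) b w =
      AdW φ (g (btgt b)) (adTransportW φ (fun b => (V b)⁻¹) b (AdW φ (g (bpos b))⁻¹ w) - AdW φ (g (bpos b))⁻¹ w) := by
  rw [B9Eq328GaugeAction.adTransportW_gaugeU_inv, B9Eq328GaugeAction.adTransportW_gaugeU_inv, adTransportW_one_inv_apply, map_sub]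

/-- **`‖R(U(b))w − R(U⁰(b))w‖ ≤ ε‖w‖` WHEN `‖R(V(b))w′ − w′‖ ≤ ε‖w′‖`** (`U = V^g`, `U⁰ = 1^g`, `g` fibrewise isometric): the `hRR′` binder of the
two-background letters (`B9Eq373DerivativeRemainderTwoBackgrounds.norm_covDerivL2K_sub_le₂`, `B9Eq373KatoPairedRemainder`) for the pair `(U, U⁰)` of
storey J — there `g := g₀⁻¹`, `V := Ũ` for the (3.35) pair `(g₀, Ũ)` of `B9Eq387CubeReductionGaugeBackground.exists_gauge_background_letters` (`U = Ũ^{g₀⁻¹}`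
on the cube's bonds by `gaugeU_inv_gaugeU`), and the displayed `hV` is `B9Eq384RemainderLetters.norm_adTransportW_sub_le` (`ε = 2M_φM_φ′·‖Ũ(b) − 1‖`).
[folklore] [cite: Balaban1985BackgroundPropagators, (3.35) p.396, (3.70) p.404, (3.28)–(3.30) p.395] -/
theorem norm_adTransportW_gaugeU_sub_pureGauge_le (hAd : ∀ (x : TSite d Pd) (v v' : W), ⟪AdW φ (g x) v, AdW φ (g x) v'⟫_ℂ = ⟪v, v'⟫_ℂ)
    (b : Bond d Pd) {ε : ℝ} (hV : ∀ w, ‖adTransportW φ V b w - w‖ ≤ ε * ‖w‖) (w : W) :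
    ‖adTransportW φ (gaugeU g V) b w - adTransportW φ (gaugeU g 1) b w‖ ≤ ε * ‖w‖ := by
  rw [adTransportW_gaugeU_sub_pureGauge, norm_AdW_of_hAd φ g hAd, ← norm_AdW_inv_of_hAd φ g hAd (btgt b) w]
  exact hV _

/-- **`‖R(U(b)⁻¹)w − R(U⁰(b)⁻¹)w‖ ≤ ε‖w‖` WHEN `‖R(V(b)⁻¹)w′ − w′‖ ≤ ε‖w′‖`** — the `hSS′` binder of the same letters. [folklore]
[cite: Balaban1985BackgroundPropagators, (3.35) p.396, (3.70) p.404, (3.8) p.392, (3.28)–(3.30) p.395] -/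
theorem norm_adTransportW_gaugeU_inv_sub_pureGauge_le (hAd : ∀ (x : TSite d Pd) (v v' : W), ⟪AdW φ (g x) v, AdW φ (g x) v'⟫_ℂ = ⟪v, v'⟫_ℂ)
    (b : Bond d Pd) {ε : ℝ} (hV' : ∀ w, ‖adTransportW φ (fun b => (V b)⁻¹) b w - w‖ ≤ ε * ‖w‖) (w : W) :
    ‖adTransportW φ (fun b => (gaugeU g V b)⁻¹) b w - adTransportW φ (fun b => (gaugeU g 1 b)⁻¹) b w‖ ≤ ε * ‖w‖ := by
  rw [adTransportW_gaugeU_inv_sub_pureGauge, norm_AdW_of_hAd φ g hAd, ← norm_AdW_inv_of_hAd φ g hAd (bpos b) w]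
  exact hV' _

end Smallness

/-! ## §6 The paired-remainder letters of the pair `(U⁰, U) = (1^g, V^g)`: the relative transporter `R(U⁰(b))R(U(b)⁻¹)` is the conjugated fibre
transporter `R(V(b)⁻¹)`, and its `U⁰`-covariant difference along the bond direction is the conjugated PLAIN difference of two consecutive fibre
transporters — so (3.73)'s `|∇_U B|` letter is the size of `R(V(x,μ)⁻¹) − R(V(x−e_μ,μ)⁻¹)`; both orders of the pair -/

section PairedLetters

variable (V : Bond d Pd → 𝔸ˣ)

/-- `R(U⁰(b))u = R(g b₋)R(g b₊)⁻¹u` for the pure gauge `U⁰ = 1^g`. [folklore] [cite: Balaban1985BackgroundPropagators, (3.28) p.395, (3.3) p.391] -/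
theorem adTransportW_pureGauge_apply (b : Bond d Pd) (u : W) :
    adTransportW φ (gaugeU g 1) b u = AdW φ (g (bpos b)) (AdW φ (g (btgt b))⁻¹ u) := by
  rw [B9Eq328GaugeAction.adTransportW_gaugeU, adTransportW_one_apply]

/-- `R(U⁰(b)⁻¹)u = R(g b₊)R(g b₋)⁻¹u` for the pure gauge `U⁰ = 1^g`. [folklore] [cite: Balaban1985BackgroundPropagators, (3.28) p.395, (3.8) p.392] -/
theorem adTransportW_pureGauge_inv_apply (b : Bond d Pd) (u : W) :
    adTransportW φ (fun b => (gaugeU g 1 b)⁻¹) b u = AdW φ (g (btgt b)) (AdW φ (g (bpos b))⁻¹ u) := by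
  rw [B9Eq328GaugeAction.adTransportW_gaugeU_inv, adTransportW_one_inv_apply]

/-- **`‖R(U⁰(b))u‖ = ‖u‖`**: the pure-gauge transporters are fibre isometries (`hAd`). [folklore] [cite: Balaban1985BackgroundPropagators, (3.30) p.395] -/
theorem norm_adTransportW_pureGauge (hAd : ∀ (x : TSite d Pd) (v v' : W), ⟪AdW φ (g x) v, AdW φ (g x) v'⟫_ℂ = ⟪v, v'⟫_ℂ)
    (b : Bond d Pd) (u : W) : ‖adTransportW φ (gaugeU g 1) b u‖ = ‖u‖ := by
  rw [adTransportW_pureGauge_apply, norm_AdW_of_hAd φ g hAd, norm_AdW_inv_of_hAd φ g hAd]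

/-- **`‖R(U⁰(b)⁻¹)u‖ = ‖u‖`** (the `hS` binder of `B9Eq373KatoPairedRemainder.norm_equiv_covLaplaceSiteK_sub_le_paired` at the pure gauge, as an
equality). [folklore] [cite: Balaban1985BackgroundPropagators, (3.30) p.395, (3.8) p.392] -/
theorem norm_adTransportW_pureGauge_inv (hAd : ∀ (x : TSite d Pd) (v v' : W), ⟪AdW φ (g x) v, AdW φ (g x) v'⟫_ℂ = ⟪v, v'⟫_ℂ)
    (b : Bond d Pd) (u : W) : ‖adTransportW φ (fun b => (gaugeU g 1 b)⁻¹) b u‖ = ‖u‖ := by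
  rw [adTransportW_pureGauge_inv_apply, norm_AdW_of_hAd φ g hAd, norm_AdW_inv_of_hAd φ g hAd]

/-- **`‖R(U(b))u‖ ≤ ‖u‖` for `U = V^g`** when `R(V(b))` contracts (the `hR′` binder of the paired remainder with `U` the second datum). [folklore]
[cite: Balaban1985BackgroundPropagators, (3.28)–(3.30) p.395] -/
theorem norm_adTransportW_gaugeU_le (hAd : ∀ (x : TSite d Pd) (v v' : W), ⟪AdW φ (g x) v, AdW φ (g x) v'⟫_ℂ = ⟪v, v'⟫_ℂ)
    (b : Bond d Pd) (hRV : ∀ w, ‖adTransportW φ V b w‖ ≤ ‖w‖) (u : W) : ‖adTransportW φ (gaugeU g V) b u‖ ≤ ‖u‖ := by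
  rw [B9Eq328GaugeAction.adTransportW_gaugeU, norm_AdW_of_hAd φ g hAd, ← norm_AdW_inv_of_hAd φ g hAd (btgt b) u]
  exact hRV _

/-- **`‖R(U(b)⁻¹)u‖ ≤ ‖u‖` for `U = V^g`** when `R(V(b)⁻¹)` contracts. [folklore] [cite: Balaban1985BackgroundPropagators, (3.28)–(3.30) p.395, (3.8) p.392] -/
theorem norm_adTransportW_gaugeU_inv_le (hAd : ∀ (x : TSite d Pd) (v v' : W), ⟪AdW φ (g x) v, AdW φ (g x) v'⟫_ℂ = ⟪v, v'⟫_ℂ)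
    (b : Bond d Pd) (hSV : ∀ w, ‖adTransportW φ (fun b => (V b)⁻¹) b w‖ ≤ ‖w‖) (u : W) :
    ‖adTransportW φ (fun b => (gaugeU g V b)⁻¹) b u‖ ≤ ‖u‖ := by
  rw [B9Eq328GaugeAction.adTransportW_gaugeU_inv, norm_AdW_of_hAd φ g hAd, ← norm_AdW_inv_of_hAd φ g hAd (bpos b) u]
  exact hSV _

/-- **THE RELATIVE TRANSPORTER OF THE PAIR `(U⁰, U)` IS THE CONJUGATED FIBRE TRANSPORTER OF `V⁻¹`**: `R(U⁰(b))R(U(b)⁻¹)u = R(g b₋)·R(V(b)⁻¹)·R(g b₋)⁻¹u`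
(print: `B = exp(−iη ad A)` in the gauge (3.35)). [folklore] [cite: Balaban1985BackgroundPropagators, (3.28) p.395, (3.70) p.404] -/
theorem relTransporter_pureGauge_apply (b : Bond d Pd) (u : W) :
    adTransportW φ (gaugeU g 1) b (adTransportW φ (fun b => (gaugeU g V b)⁻¹) b u) =
      AdW φ (g (bpos b)) (adTransportW φ (fun b => (V b)⁻¹) b (AdW φ (g (bpos b))⁻¹ u)) := by
  rw [B9Eq328GaugeAction.adTransportW_gaugeU_inv, B9Eq328GaugeAction.adTransportW_gaugeU, adTransportW_one_apply,
    B9Eq328GaugeAction.AdW_inv_apply]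

/-- `R(U⁰(b))R(U(b)⁻¹)u − u = R(g b₋)·(R(V(b)⁻¹)y − y)`, `y = R(g b₋)⁻¹u`. [folklore] [cite: Balaban1985BackgroundPropagators, (3.28) p.395, (3.70) p.404] -/
theorem relTransporter_pureGauge_sub_apply (b : Bond d Pd) (u : W) :
    adTransportW φ (gaugeU g 1) b (adTransportW φ (fun b => (gaugeU g V b)⁻¹) b u) - u =
      AdW φ (g (bpos b)) (adTransportW φ (fun b => (V b)⁻¹) b (AdW φ (g (bpos b))⁻¹ u) - AdW φ (g (bpos b))⁻¹ u) := by
  rw [relTransporter_pureGauge_apply, map_sub, AdW_apply_inv]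

/-- **`‖R(U⁰(b))R(U(b)⁻¹)u − u‖ ≤ ε‖u‖` WHEN `‖R(V(b)⁻¹)w − w‖ ≤ ε‖w‖`** — the `hBp`∕`hBm` binders (relative transporter minus one) of
`B9Eq373KatoPairedRemainder.norm_equiv_covLaplaceSiteK_sub_le_paired` for the pair `(U⁰, U) = (1^g, V^g)`; the displayed `hV′` is
`B9Eq384RemainderLetters.norm_adTransportW_sub_le` at `V⁻¹` (`ε = 2M_φM_φ′·‖V(b) − 1‖`). [folklore] [cite: Balaban1985BackgroundPropagators, (3.70) p.404, (3.73) p.405] -/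
theorem norm_relTransporter_pureGauge_sub_le (hAd : ∀ (x : TSite d Pd) (v v' : W), ⟪AdW φ (g x) v, AdW φ (g x) v'⟫_ℂ = ⟪v, v'⟫_ℂ)
    (b : Bond d Pd) {ε : ℝ} (hV' : ∀ w, ‖adTransportW φ (fun b => (V b)⁻¹) b w - w‖ ≤ ε * ‖w‖) (u : W) :
    ‖adTransportW φ (gaugeU g 1) b (adTransportW φ (fun b => (gaugeU g V b)⁻¹) b u) - u‖ ≤ ε * ‖u‖ := by
  rw [relTransporter_pureGauge_sub_apply, norm_AdW_of_hAd φ g hAd, ← norm_AdW_inv_of_hAd φ g hAd (bpos b) u]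
  exact hV' _

/-- **`‖R(U⁰(b)⁻¹)u − R(U(b)⁻¹)u‖ ≤ ε‖u‖` WHEN `‖R(V(b)⁻¹)w − w‖ ≤ ε‖w‖`** — the `hBt` binder (difference of the adjoint transporters, pure gauge
first) of the paired remainder; §5 read in the other order. [folklore] [cite: Balaban1985BackgroundPropagators, (3.70) p.404, (3.8) p.392] -/
theorem norm_adTransportW_pureGauge_inv_sub_gaugeU_inv_le (hAd : ∀ (x : TSite d Pd) (v v' : W), ⟪AdW φ (g x) v, AdW φ (g x) v'⟫_ℂ = ⟪v, v'⟫_ℂ)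
    (b : Bond d Pd) {ε : ℝ} (hV' : ∀ w, ‖adTransportW φ (fun b => (V b)⁻¹) b w - w‖ ≤ ε * ‖w‖) (u : W) :
    ‖adTransportW φ (fun b => (gaugeU g 1 b)⁻¹) b u - adTransportW φ (fun b => (gaugeU g V b)⁻¹) b u‖ ≤ ε * ‖u‖ := by
  rw [norm_sub_rev]
  exact norm_adTransportW_gaugeU_inv_sub_pureGauge_le φ g V hAd b hV' u

/-- **THE `U⁰`-COVARIANT DIFFERENCE OF THE RELATIVE TRANSPORTER ALONG THE BOND DIRECTION IS THE CONJUGATED PLAIN DIFFERENCE OF CONSECUTIVE FIBRE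
TRANSPORTERS**: with `B(b) = R(U⁰(b))R(U(b)⁻¹) − 1` for the pair `(U⁰, U) = (1^g, V^g)`,
`B(x,μ)u − R(U⁰(x−e_μ,μ)⁻¹)·B(x−e_μ,μ)·R(U⁰(x−e_μ,μ))u = R(g x)·(R(V(x,μ)⁻¹) − R(V(x−e_μ,μ)⁻¹))·R(g x)⁻¹u` — the gauge drops out but for the
conjugation at the common site `x`; print's *«the derivatives are, of course, the covariant derivatives defined by U»* ((3.73)): in the gauge (3.35)
the letter is `exp(−iη ad A(x,μ)) − exp(−iη ad A(x−e_μ,μ)) = O(η²|∇^ηA|)`. [folklore] [cite: Balaban1985BackgroundPropagators, (3.73) p.405, (3.28) p.395, (3.35) p.396] -/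
theorem covDiff_relTransporter_pureGauge_eq (x : TSite d Pd) (μ : Fin d) (u : W) :
    (adTransportW φ (gaugeU g 1) (x, μ) (adTransportW φ (fun b => (gaugeU g V b)⁻¹) (x, μ) u) - u) -
      adTransportW φ (fun b => (gaugeU g 1 b)⁻¹) (unshift μ x, μ)
        (adTransportW φ (gaugeU g 1) (unshift μ x, μ) (adTransportW φ (fun b => (gaugeU g V b)⁻¹) (unshift μ x, μ)
          (adTransportW φ (gaugeU g 1) (unshift μ x, μ) u)) - adTransportW φ (gaugeU g 1) (unshift μ x, μ) u) =
      AdW φ (g x) (adTransportW φ (fun b => (V b)⁻¹) (x, μ) (AdW φ (g x)⁻¹ u) -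
        adTransportW φ (fun b => (V b)⁻¹) (unshift μ x, μ) (AdW φ (g x)⁻¹ u)) := by
  rw [relTransporter_pureGauge_apply, relTransporter_pureGauge_apply, adTransportW_pureGauge_apply, adTransportW_pureGauge_inv_apply]
  simp only [bpos, btgt, shift_unshift, B9Eq328GaugeAction.AdW_inv_apply, AdW_apply_inv, map_sub]
  abel

/-- **THE (3.73) `|∇_U B|` LETTER OF THE PAIRED REMAINDER FOR THE PAIR `(U⁰, U) = (1^g, V^g)`**: if the consecutive inverse fibre transporters of `V`
along `μ` at `x` are close — `‖R(V(x,μ)⁻¹)w − R(V(x−e_μ,μ)⁻¹)w‖ ≤ ε′‖w‖` — then the `hD` binder of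
`B9Eq373KatoPairedRemainder.norm_equiv_covLaplaceSiteK_sub_le_paired` (first datum the pure gauge `U⁰`, second datum `U`) holds with `b′ = ε′`:
`‖B(x,μ)u − R(U⁰(x−e_μ,μ)⁻¹)B(x−e_μ,μ)R(U⁰(x−e_μ,μ))u‖ ≤ ε′‖u‖`.  In print's units `ε′ = O(η²·|∇^ηA|) = O(η²Mα₀(Lʲη)⁻²)` under (3.35) — the
zeroth-order slot of the paired bound then carries `η⁻²·ε′ = O(Mα₀)`, `η`-free. [folklore] [cite: Balaban1985BackgroundPropagators, (3.73) p.405, (3.35) p.396] -/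
theorem norm_covDiff_relTransporter_pureGauge_le (hAd : ∀ (x : TSite d Pd) (v v' : W), ⟪AdW φ (g x) v, AdW φ (g x) v'⟫_ℂ = ⟪v, v'⟫_ℂ)
    (x : TSite d Pd) (μ : Fin d) {ε' : ℝ}
    (hdV' : ∀ w, ‖adTransportW φ (fun b => (V b)⁻¹) (x, μ) w - adTransportW φ (fun b => (V b)⁻¹) (unshift μ x, μ) w‖ ≤ ε' * ‖w‖) (u : W) :
    ‖(adTransportW φ (gaugeU g 1) (x, μ) (adTransportW φ (fun b => (gaugeU g V b)⁻¹) (x, μ) u) - u) -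
      adTransportW φ (fun b => (gaugeU g 1 b)⁻¹) (unshift μ x, μ)
        (adTransportW φ (gaugeU g 1) (unshift μ x, μ) (adTransportW φ (fun b => (gaugeU g V b)⁻¹) (unshift μ x, μ)
          (adTransportW φ (gaugeU g 1) (unshift μ x, μ) u)) - adTransportW φ (gaugeU g 1) (unshift μ x, μ) u)‖ ≤ ε' * ‖u‖ := by
  rw [covDiff_relTransporter_pureGauge_eq, norm_AdW_of_hAd φ g hAd, ← norm_AdW_inv_of_hAd φ g hAd x u]
  exact hdV' _

/-! ### The other order `(U, U⁰) = (V^g, 1^g)`: relative transporter `R(g b₋)·R(V(b))·R(g b₋)⁻¹`, covariant difference transported by `U` -/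

/-- `R(U(b))R(U⁰(b)⁻¹)u = R(g b₋)·R(V(b))·R(g b₋)⁻¹u` for `(U, U⁰) = (V^g, 1^g)`. [folklore] [cite: Balaban1985BackgroundPropagators, (3.28) p.395, (3.70) p.404] -/
theorem relTransporter_gaugeU_apply (b : Bond d Pd) (u : W) :
    adTransportW φ (gaugeU g V) b (adTransportW φ (fun b => (gaugeU g 1 b)⁻¹) b u) =
      AdW φ (g (bpos b)) (adTransportW φ V b (AdW φ (g (bpos b))⁻¹ u)) := by
  rw [adTransportW_pureGauge_inv_apply, B9Eq328GaugeAction.adTransportW_gaugeU, B9Eq328GaugeAction.AdW_inv_apply]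

/-- `R(U(b))R(U⁰(b)⁻¹)u − u = R(g b₋)·(R(V(b))y − y)`, `y = R(g b₋)⁻¹u`. [folklore] [cite: Balaban1985BackgroundPropagators, (3.28) p.395, (3.70) p.404] -/
theorem relTransporter_gaugeU_sub_apply (b : Bond d Pd) (u : W) :
    adTransportW φ (gaugeU g V) b (adTransportW φ (fun b => (gaugeU g 1 b)⁻¹) b u) - u =
      AdW φ (g (bpos b)) (adTransportW φ V b (AdW φ (g (bpos b))⁻¹ u) - AdW φ (g (bpos b))⁻¹ u) := by
  rw [relTransporter_gaugeU_apply, map_sub, AdW_apply_inv]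

/-- **`‖R(U(b))R(U⁰(b)⁻¹)u − u‖ ≤ ε‖u‖` WHEN `‖R(V(b))w − w‖ ≤ ε‖w‖`** — the `hBp`∕`hBm` binders of the paired remainder for the order `(U, U⁰)`;
`hV` is `B9Eq384RemainderLetters.norm_adTransportW_sub_le`. [folklore] [cite: Balaban1985BackgroundPropagators, (3.70) p.404, (3.73) p.405] -/
theorem norm_relTransporter_gaugeU_sub_le (hAd : ∀ (x : TSite d Pd) (v v' : W), ⟪AdW φ (g x) v, AdW φ (g x) v'⟫_ℂ = ⟪v, v'⟫_ℂ)
    (b : Bond d Pd) {ε : ℝ} (hV : ∀ w, ‖adTransportW φ V b w - w‖ ≤ ε * ‖w‖) (u : W) :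
    ‖adTransportW φ (gaugeU g V) b (adTransportW φ (fun b => (gaugeU g 1 b)⁻¹) b u) - u‖ ≤ ε * ‖u‖ := by
  rw [relTransporter_gaugeU_sub_apply, norm_AdW_of_hAd φ g hAd, ← norm_AdW_inv_of_hAd φ g hAd (bpos b) u]
  exact hV _

/-- `R(V(b)⁻¹)R(V(b)) = 1` on the fibre (no hypothesis). [folklore] [cite: Balaban1985BackgroundPropagators, (3.8) p.392] -/
theorem adTransportW_inv_adTransportW (b : Bond d Pd) (w : W) :
    adTransportW φ (fun b => (V b)⁻¹) b (adTransportW φ V b w) = w := by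
  rw [adTransportW_eq_AdW, adTransportW_eq_AdW, B9Eq328GaugeAction.AdW_inv_apply]

/-- **THE `U`-COVARIANT DIFFERENCE OF THE RELATIVE TRANSPORTER, ORDER `(U, U⁰) = (V^g, 1^g)`**: with `B(b) = R(U(b))R(U⁰(b)⁻¹) − 1`,
`B(x,μ)u − R(U(x−e_μ,μ)⁻¹)·B(x−e_μ,μ)·R(U(x−e_μ,μ))u = R(g x)·(R(V(x,μ)) − R(V(x−e_μ,μ)))·R(g x)⁻¹u`. [folklore]
[cite: Balaban1985BackgroundPropagators, (3.73) p.405, (3.28) p.395] -/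
theorem covDiff_relTransporter_gaugeU_eq (x : TSite d Pd) (μ : Fin d) (u : W) :
    (adTransportW φ (gaugeU g V) (x, μ) (adTransportW φ (fun b => (gaugeU g 1 b)⁻¹) (x, μ) u) - u) -
      adTransportW φ (fun b => (gaugeU g V b)⁻¹) (unshift μ x, μ)
        (adTransportW φ (gaugeU g V) (unshift μ x, μ) (adTransportW φ (fun b => (gaugeU g 1 b)⁻¹) (unshift μ x, μ)
          (adTransportW φ (gaugeU g V) (unshift μ x, μ) u)) - adTransportW φ (gaugeU g V) (unshift μ x, μ) u) =
      AdW φ (g x) (adTransportW φ V (x, μ) (AdW φ (g x)⁻¹ u) - adTransportW φ V (unshift μ x, μ) (AdW φ (g x)⁻¹ u)) := by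
  rw [relTransporter_gaugeU_apply, relTransporter_gaugeU_apply, B9Eq328GaugeAction.adTransportW_gaugeU,
    B9Eq328GaugeAction.adTransportW_gaugeU_inv]
  simp only [bpos, btgt, shift_unshift, B9Eq328GaugeAction.AdW_inv_apply, AdW_apply_inv, map_sub, adTransportW_inv_adTransportW]
  abel

/-- **THE (3.73) `|∇_U B|` LETTER, ORDER `(U, U⁰) = (V^g, 1^g)`**: `‖R(V(x,μ))w − R(V(x−e_μ,μ))w‖ ≤ ε′‖w‖` ⟹ the `hD` binder of the paired remainder
(first datum `U`, second the pure gauge) with `b′ = ε′`. [folklore] [cite: Balaban1985BackgroundPropagators, (3.73) p.405, (3.35) p.396] -/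
theorem norm_covDiff_relTransporter_gaugeU_le (hAd : ∀ (x : TSite d Pd) (v v' : W), ⟪AdW φ (g x) v, AdW φ (g x) v'⟫_ℂ = ⟪v, v'⟫_ℂ)
    (x : TSite d Pd) (μ : Fin d) {ε' : ℝ}
    (hdV : ∀ w, ‖adTransportW φ V (x, μ) w - adTransportW φ V (unshift μ x, μ) w‖ ≤ ε' * ‖w‖) (u : W) :
    ‖(adTransportW φ (gaugeU g V) (x, μ) (adTransportW φ (fun b => (gaugeU g 1 b)⁻¹) (x, μ) u) - u) -
      adTransportW φ (fun b => (gaugeU g V b)⁻¹) (unshift μ x, μ)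
        (adTransportW φ (gaugeU g V) (unshift μ x, μ) (adTransportW φ (fun b => (gaugeU g 1 b)⁻¹) (unshift μ x, μ)
          (adTransportW φ (gaugeU g V) (unshift μ x, μ) u)) - adTransportW φ (gaugeU g V) (unshift μ x, μ) u)‖ ≤ ε' * ‖u‖ := by
  rw [covDiff_relTransporter_gaugeU_eq, norm_AdW_of_hAd φ g hAd, ← norm_AdW_inv_of_hAd φ g hAd x u]
  exact hdV _

end PairedLetters

end Literature.MathematicalPhysics.QuantumFieldTheory.Balaban1983to89.B9Eq331PureGaugeResolventConjugation

end
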